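import Literature.AlgebraicGeometry.Resolution.LogRegularScheme
import Mathlib.RingTheory.RegularLocalRing.Defs
import HarnessLib

/-!
# Crux `FrobeniusLadder.FRationalResolution` (stmt-ResolutionOfSingularities-15317), line `redirect`,
# stub `stub_diagonalizableQuotientResolution` — **points of a log regular scheme whose stratum is
# zero-dimensional: Kato's ideal IS the maximal ideal** (entry brick of the point-blow-up recursion
# for the surface case over arbitrary fields, memo MEMO-15317-leafhand2-g6 §3, brick P3)

Generic log-geometry lemmas (Kato 1994, Def. (2.1)), no gradings, no schemes. For a chart
`φ : P → R` through a local ring `R` (`P ⊆ ℤⁿ`), Kato's condition (2.1) says that `R/I(φ)` is a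
regular local ring and `dim R = dim R/I(φ) + (n − rk Fᵍᵖ)`, `I(φ) = φ(P ∖ F)·R` the ideal of the
non-units of the chart (`LogChart.nonunitIdeal`), `F` the face of units. At a point whose log
stratum `Spec R/I(φ)` is ZERO-dimensional — equivalently (given (2.1)) a point where the rank term
`n − rk Fᵍᵖ` equals `dim R` — the regular zero-dimensional local ring `R/I(φ)` is a field, so

  **`I(φ) = 𝔪_R`: the maximal ideal is generated by the images of the chart elements.**

Consequently the blowing up of the (reduced) closed point of `Spec R` is the blowing up of the
MONOID ideal `P ∖ F` — the log blow-up whose charts are the tree's `LogChart.blowupChart`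
(`LogBlowupChart.lean`); this is how the point-blow-up recursion for étale-locally log regular
normal surfaces (every singular point of such a surface is a point of full rank `2`) enters Kato's
chart calculus. Also recorded: the converse bookkeeping (`I(φ) = 𝔪_R` ⇒ the stratum is
zero-dimensional and `dim R` is the rank term) and the `A_𝔭` forms for the affine one-chart
predicate `LogChart.IsLogRegularAt` (`LogRegularResolution.lean`).

* `eq_maximalIdeal_of_isRegularLocalRing_quotient` — `R/J` regular local of dimension `0` ⇒ `J = 𝔪_R`;
* `withBot_enat_eq_zero_of_add_natCast_eq` — `b + r = r` in `WithBot ℕ∞` with `0 ≤ b`, `r : ℕ` ⇒ `b = 0`;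
* `nonunitIdeal_eq_maximalIdeal_of_ringKrullDim_quotient_eq_zero`, `…_of_ringKrullDim_eq_rank` —
  THE LEMMA, local-ring chart form; `ringKrullDim_quotient_eq_zero_of_nonunitIdeal_eq_maximalIdeal`,
  `ringKrullDim_eq_rank_of_nonunitIdeal_eq_maximalIdeal` — converse bookkeeping;
* `ideal_map_eq_maximalIdeal_of_ringKrullDim_quotient_eq_zero`, `…_of_ringKrullDim_eq_rank`,
  `ideal_map_eq_map_prime_of_ringKrullDim_eq_rank` — the `A_𝔭` forms (`LogChart.IsLogRegularAt`).

References: [Kato1994] K. Kato, *Toric singularities*, Amer. J. Math. 116 (1994), Def. (2.1),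
(2.2); [Niziol2006] Def. 2.2. Folklore bookkeeping; no new definitions, no named facts, no sorry.
-/

noncomputable section

-- single-problem summit: the doubled namespace component is forced
set_option linter.dupNamespace false

open IsLocalRing
open Literature.AlgebraicGeometry.Resolution

namespace Summit.ResolutionOfSingularities.ResolutionOfSingularities.Theorems.FRationalResolution.LogClosedStratumPoint

universe u

/-! ## Generic: a regular local quotient of dimension zero is the residue field -/

/-- **A regular local ring of dimension `0` is a field; hence if `R/J` is regular local of
dimension `0` then `J` is the maximal ideal of the local ring `R`.** (Regular: `𝔪` is generated
by `dim = 0` elements, so `𝔪_{R/J} = ⊥`.) [folklore; cite: Kato1994, (2.2)] -/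
theorem eq_maximalIdeal_of_isRegularLocalRing_quotient {R : Type u} [CommRing R] [IsLocalRing R]
    (J : Ideal R) [hJ : IsRegularLocalRing (R ⧸ J)] (h0 : ringKrullDim (R ⧸ J) = 0) :
    J = maximalIdeal R := by
  have hspan : ((maximalIdeal (R ⧸ J)).spanFinrank : WithBot ℕ∞) = 0 := by
    rw [hJ.spanFinrank_maximalIdeal, h0]
  have hspan0 : (maximalIdeal (R ⧸ J)).spanFinrank = 0 := by
    exact_mod_cast hspan
  have hfg : (maximalIdeal (R ⧸ J)).FG := IsNoetherian.noetherian _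
  have hbot : maximalIdeal (R ⧸ J) = ⊥ :=
    (Submodule.spanFinrank_eq_zero_iff_eq_bot hfg).mp hspan0
  have hfield : IsField (R ⧸ J) := (IsLocalRing.isField_iff_maximalIdeal_eq).mpr hbot
  exact IsLocalRing.eq_maximalIdeal (Ideal.Quotient.maximal_of_isField J hfield)

/-- Conversely, the quotient of a local ring by its maximal ideal has Krull dimension `0`.
[folklore] -/
theorem ringKrullDim_quotient_maximalIdeal {R : Type u} [CommRing R] [IsLocalRing R] :
    ringKrullDim (R ⧸ maximalIdeal R) = 0 := by
  exact ringKrullDim_eq_zero_of_isField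
    ((Ideal.Quotient.maximal_ideal_iff_isField_quotient (maximalIdeal R)).mp
      (maximalIdeal.isMaximal R))

/-- Arithmetic in `WithBot ℕ∞` (the codomain of `ringKrullDim`): if `b + r = r` with `0 ≤ b` and
`r` a natural number, then `b = 0`. [folklore] -/
theorem withBot_enat_eq_zero_of_add_natCast_eq {b : WithBot ℕ∞} {r : ℕ} (hb : 0 ≤ b)
    (h : b + (r : WithBot ℕ∞) = (r : WithBot ℕ∞)) : b = 0 := by
  obtain ⟨m, rfl⟩ := WithBot.ne_bot_iff_exists.mp (ne_bot_of_le_ne_bot WithBot.zero_ne_bot hb)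
  have h' : (m : WithBot ℕ∞) + ((r : ℕ∞) : WithBot ℕ∞) = ((r : ℕ∞) : WithBot ℕ∞) := h
  rw [← WithBot.coe_add, WithBot.coe_inj] at h'
  have hm : m = 0 := by
    induction m using ENat.recTopCoe with
    | top => simp at h'
    | coe m =>
      have : ((m + r : ℕ) : ℕ∞) = (r : ℕ∞) := by push_cast; exact h'
      have hmr : m + r = r := by exact_mod_cast this
      have : m = 0 := by omega
      simp [this]
  simp [hm]

/-! ## The lemma for a chart through a local ring (`LogChart.IsLogRegularLocal`) -/

variable {n : ℕ} {R : Type u} [CommRing R] [IsLocalRing R]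

/-- **Kato's ideal is the maximal ideal at a point with zero-dimensional stratum.** For a chart
`φ : P → R` through a local ring satisfying Kato's condition (2.1) (`LogChart.IsLogRegularLocal`),
if `dim R/I(φ) = 0` then `I(φ) = φ(P ∖ F)·R` is the maximal ideal of `R`.
[cite: Kato1994, Def. (2.1)] -/
theorem nonunitIdeal_eq_maximalIdeal_of_ringKrullDim_quotient_eq_zero
    (P : AddSubmonoid (Fin n → ℤ)) (φ : Multiplicative P →* R)
    (hreg : LogChart.IsLogRegularLocal P φ)
    (h0 : ringKrullDim (R ⧸ LogChart.nonunitIdeal P φ) = 0) :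
    LogChart.nonunitIdeal P φ = maximalIdeal R := by
  haveI := hreg.1
  exact eq_maximalIdeal_of_isRegularLocalRing_quotient _ h0

/-- **Kato's ideal is the maximal ideal at a point of full rank.** For a chart `φ : P → R`
through a local ring satisfying Kato's condition (2.1), if `dim R` equals the rank term
`n − rk Fᵍᵖ` of (2.1) (so that the regular local ring `R/I(φ)` is zero-dimensional), then
`I(φ) = 𝔪_R`. This is the case of every SINGULAR point of a log regular surface (rank `≤ 1` points
are regular). [cite: Kato1994, Def. (2.1)] -/
theorem nonunitIdeal_eq_maximalIdeal_of_ringKrullDim_eq_rank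
    (P : AddSubmonoid (Fin n → ℤ)) (φ : Multiplicative P →* R)
    (hreg : LogChart.IsLogRegularLocal P φ)
    (hdim : ringKrullDim R = ((n - Module.finrank ℤ
      (Submodule.span ℤ ((fun p : P => (p : Fin n → ℤ)) '' LogChart.unitFace P φ)) : ℕ) : WithBot ℕ∞)) :
    LogChart.nonunitIdeal P φ = maximalIdeal R := by
  haveI := hreg.1
  refine nonunitIdeal_eq_maximalIdeal_of_ringKrullDim_quotient_eq_zero P φ hreg ?_
  have h := hreg.2
  rw [hdim] at h
  exact withBot_enat_eq_zero_of_add_natCast_eq ringKrullDim_nonneg_of_nontrivial h.symm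

/-- Converse bookkeeping (no log regularity needed): if Kato's ideal is the maximal ideal then the
stratum `Spec R/I(φ)` is zero-dimensional. [folklore] -/
theorem ringKrullDim_quotient_eq_zero_of_nonunitIdeal_eq_maximalIdeal
    (P : AddSubmonoid (Fin n → ℤ)) (φ : Multiplicative P →* R)
    (h : LogChart.nonunitIdeal P φ = maximalIdeal R) :
    ringKrullDim (R ⧸ LogChart.nonunitIdeal P φ) = 0 := by
  rw [h]
  exact ringKrullDim_quotient_maximalIdeal

/-- Converse bookkeeping under (2.1): if Kato's ideal is the maximal ideal then `dim R` is the rank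
term `n − rk Fᵍᵖ`. [cite: Kato1994, Def. (2.1)] -/
theorem ringKrullDim_eq_rank_of_nonunitIdeal_eq_maximalIdeal
    (P : AddSubmonoid (Fin n → ℤ)) (φ : Multiplicative P →* R)
    (hreg : LogChart.IsLogRegularLocal P φ) (h : LogChart.nonunitIdeal P φ = maximalIdeal R) :
    ringKrullDim R = ((n - Module.finrank ℤ
      (Submodule.span ℤ ((fun p : P => (p : Fin n → ℤ)) '' LogChart.unitFace P φ)) : ℕ) : WithBot ℕ∞) := by
  rw [hreg.2, ringKrullDim_quotient_eq_zero_of_nonunitIdeal_eq_maximalIdeal P φ h, zero_add]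

/-- At a point with zero-dimensional stratum the maximal ideal is generated by chart elements:
every element of `𝔪_R` lies in the ideal spanned by the `φ(p)`, `p ∈ P` a non-unit of the chart.
[cite: Kato1994, Def. (2.1)] -/
theorem maximalIdeal_eq_span_image_of_ringKrullDim_eq_rank
    (P : AddSubmonoid (Fin n → ℤ)) (φ : Multiplicative P →* R)
    (hreg : LogChart.IsLogRegularLocal P φ)
    (hdim : ringKrullDim R = ((n - Module.finrank ℤ
      (Submodule.span ℤ ((fun p : P => (p : Fin n → ℤ)) '' LogChart.unitFace P φ)) : ℕ) : WithBot ℕ∞)) :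
    maximalIdeal R = Ideal.span ((fun p : P => φ (Multiplicative.ofAdd p)) ''
      {p | ¬ IsUnit (φ (Multiplicative.ofAdd p))}) :=
  (nonunitIdeal_eq_maximalIdeal_of_ringKrullDim_eq_rank P φ hreg hdim).symm

/-! ## The `A_𝔭` forms (`LogChart.IsLogRegularAt`) -/

section Localization

variable {A : Type u} [CommRing A]

/-- **`A_𝔭` form, zero-dimensional stratum.** For the affine one-chart predicate
`LogChart.IsLogRegularAt P φ 𝔭`: if `dim A_𝔭/I(𝔭)A_𝔭 = 0` then `I(𝔭)A_𝔭 = 𝔭A_𝔭`, the maximal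
ideal of `A_𝔭` (`I(𝔭) = φ(P ∖ F_𝔭)·A`, `LogChart.ideal`). [cite: Kato1994, Def. (2.1)] -/
theorem ideal_map_eq_maximalIdeal_of_ringKrullDim_quotient_eq_zero
    (P : AddSubmonoid (Fin n → ℤ)) (φ : Multiplicative P →* A) (𝔭 : Ideal A) [𝔭.IsPrime]
    (hreg : LogChart.IsLogRegularAt P φ 𝔭)
    (h0 : ringKrullDim (Localization.AtPrime 𝔭 ⧸
      (LogChart.ideal P φ 𝔭).map (algebraMap A (Localization.AtPrime 𝔭))) = 0) :
    (LogChart.ideal P φ 𝔭).map (algebraMap A (Localization.AtPrime 𝔭)) =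
      maximalIdeal (Localization.AtPrime 𝔭) := by
  haveI := hreg.1
  exact eq_maximalIdeal_of_isRegularLocalRing_quotient _ h0

/-- **`A_𝔭` form, full rank.** If `(A, φ)` is log regular at `𝔭` and `dim A_𝔭` is the rank term
`n − rk F_𝔭ᵍᵖ`, then `I(𝔭)A_𝔭` is the maximal ideal of `A_𝔭`. [cite: Kato1994, Def. (2.1)] -/
theorem ideal_map_eq_maximalIdeal_of_ringKrullDim_eq_rank
    (P : AddSubmonoid (Fin n → ℤ)) (φ : Multiplicative P →* A) (𝔭 : Ideal A) [𝔭.IsPrime]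
    (hreg : LogChart.IsLogRegularAt P φ 𝔭)
    (hdim : ringKrullDim (Localization.AtPrime 𝔭) = ((n - Module.finrank ℤ
      (Submodule.span ℤ ((fun p : P => (p : Fin n → ℤ)) '' LogChart.face P φ 𝔭)) : ℕ) : WithBot ℕ∞)) :
    (LogChart.ideal P φ 𝔭).map (algebraMap A (Localization.AtPrime 𝔭)) =
      maximalIdeal (Localization.AtPrime 𝔭) := by
  haveI := hreg.1
  refine ideal_map_eq_maximalIdeal_of_ringKrullDim_quotient_eq_zero P φ 𝔭 hreg ?_
  have h := hreg.2
  rw [hdim] at h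
  exact withBot_enat_eq_zero_of_add_natCast_eq ringKrullDim_nonneg_of_nontrivial h.symm

/-- **`A_𝔭` form, full rank, in terms of `𝔭`**: `I(𝔭)A_𝔭 = 𝔭A_𝔭` — the blowing up of `Spec A_𝔭`
at its closed point is the blowing up of the monoid ideal `P ∖ F_𝔭` of the chart.
[cite: Kato1994, Def. (2.1)] -/
theorem ideal_map_eq_map_prime_of_ringKrullDim_eq_rank
    (P : AddSubmonoid (Fin n → ℤ)) (φ : Multiplicative P →* A) (𝔭 : Ideal A) [𝔭.IsPrime]
    (hreg : LogChart.IsLogRegularAt P φ 𝔭)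
    (hdim : ringKrullDim (Localization.AtPrime 𝔭) = ((n - Module.finrank ℤ
      (Submodule.span ℤ ((fun p : P => (p : Fin n → ℤ)) '' LogChart.face P φ 𝔭)) : ℕ) : WithBot ℕ∞)) :
    (LogChart.ideal P φ 𝔭).map (algebraMap A (Localization.AtPrime 𝔭)) =
      𝔭.map (algebraMap A (Localization.AtPrime 𝔭)) := by
  rw [ideal_map_eq_maximalIdeal_of_ringKrullDim_eq_rank P φ 𝔭 hreg hdim,
    Localization.AtPrime.map_eq_maximalIdeal]

/-- The `A_𝔭` form of the converse bookkeeping: if `I(𝔭)A_𝔭` is the maximal ideal then, under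
(2.1), `dim A_𝔭` is the rank term. [cite: Kato1994, Def. (2.1)] -/
theorem ringKrullDim_localization_eq_rank_of_ideal_map_eq_maximalIdeal
    (P : AddSubmonoid (Fin n → ℤ)) (φ : Multiplicative P →* A) (𝔭 : Ideal A) [𝔭.IsPrime]
    (hreg : LogChart.IsLogRegularAt P φ 𝔭)
    (h : (LogChart.ideal P φ 𝔭).map (algebraMap A (Localization.AtPrime 𝔭)) =
      maximalIdeal (Localization.AtPrime 𝔭)) :
    ringKrullDim (Localization.AtPrime 𝔭) = ((n - Module.finrank ℤ
      (Submodule.span ℤ ((fun p : P => (p : Fin n → ℤ)) '' LogChart.face P φ 𝔭)) : ℕ) : WithBot ℕ∞) := by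
  rw [hreg.2, h, ringKrullDim_quotient_maximalIdeal, zero_add]

end Localization

end Summit.ResolutionOfSingularities.ResolutionOfSingularities.Theorems.FRationalResolution.LogClosedStratumPoint

end
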